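import Mathlib
import HarnessLib
import Summits.HubbardSuperconductivity.HubbardSuperconductivity.Theorems.KLProgrammeKLRegimeEngineDressedAliasingLast

/-!
# K3 gen-8-FLOW (stmt 20437, stub (C), «(C)-B-LAST» / located finding «(C)-B-LAST-SIZE» (S2)): THE DRESSED ALIASING LEMMA WITH A GRADED
# LEIBNIZ TERM — `Σ_i C(j,i)·D_{q,i}·M_{j−i}(H)` instead of `2ʲ·(max_i D_{q,i})·M_j(H)`

Cell gate-hubbard-kl, seat p2 g16.  Layer 3′ (`…DressedAliasingLast.norm_iteratedFDeriv_evalM_symInterp_dressed_le_of_jets`, p593524) packages the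
Leibniz term at the reading point as `2·2ʲ·D_q·M_j` with ONE jet size `D_q ≥ ‖Dⁱg(q)‖` for all `i ≤ j` and the TOP moment `M_j` — at the last flow
step both factors cost `Λ_m^{−j}` (top jet × top moment ≈ `Λ_m^{−2j}`), which the (B)-fit budget `μc_j·U²·4^{(j−2)(m+1)}` cannot absorb (located finding
«(C)-B-LAST-SIZE», KL STATUS 2026-08-28).  The honest Leibniz distribution spends `i` derivatives on the dressing factor and `j − i` on the lattice
factor; this file proves the GRADED twins

* `norm_iteratedFDeriv_mul_cosPoly_le_graded` — `‖Dʲ(g·P)(q)‖ ≤ Σ_{i≤j} C(j,i)·D_{q,i}·Σ_y|c_y|(1+|y₀|+|y₁|)^{j−i}` for `‖Dⁱg(q)‖ ≤ D_{q,i}`;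
* **`norm_iteratedFDeriv_evalM_symInterp_dressed_le_of_jets_graded`** — layer 3′ with per-order jets `D_q : ℕ → ℝ` and per-order position moments
  `M : ℕ → ℝ` (`Σ_x (1+|x̃₀|+|x̃₁|)ᵏ‖𝔉⁻¹H(x)‖ ≤ M k`, `k ≤ j`):
  `‖Dʲ[evalM (symInterp L Re(g∘p·H))](q)‖ ≤ (2·Σ_{i≤j} C(j,i)·D_{q,i}·M_{j−i} + 2·(2·M_j·(3ʲ·D_g·(2/N)^{M−j−4}·4C₂))) + L²Lʲ·A₀·M_s/(1+L/4)ˢ`.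

Everything else (the `(B,c)` near polynomials, c4a-1's generic aliasing lemma twice, the far part) is p593524 verbatim.  Pure harmonic analysis; no
definitions; nothing about the Hubbard model is asserted; nothing asserts superconductivity.  References: BGM 2006 §2.3 (2.17)
[cite: BenfattoGiulianiMastropietro2006]; Boyd 2001 §4.5 Thm 19–20 [cite: Boyd2001]; Grafakos 2014 §3.3.3 [cite: Grafakos2014].
-/

noncomputable section

namespace Summit.HubbardSuperconductivity.HubbardSuperconductivity.Theorems.EngineV8

set_option linter.dupNamespace false -- summit = problem name (single-conjunct summit), D-0017

open Real Finset Filter Literature.MathematicalPhysics.QuantumLattice Literature.Probability.LatticeModels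
open Summit.HubbardSuperconductivity.HubbardSuperconductivity.Theorems.KLRegimeSplit
open Summit.HubbardSuperconductivity.HubbardSuperconductivity.Theorems.C4a
open scoped ComplexConjugate

variable {L : ℕ} [NeZero L]

/-! ## §1 Graded Leibniz at the reading point -/

section Leibniz

omit [NeZero L]

/-- **`‖Dʲ(g·P)(q)‖ ≤ Σ_{i≤j} C(j,i)·D_{q,i}·Σ_y|c_y|(1+|y₀|+|y₁|)^{j−i}`** for a smooth real `g` with `‖Dⁱg(q)‖ ≤ D_{q,i}` (`i ≤ j`) and a `(B,c)` cosine
polynomial `P` — the graded twin of `norm_iteratedFDeriv_mul_cosPoly_le`. [cite: BenfattoGiulianiMastropietro2006, §2.3 (2.17)] -/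
theorem norm_iteratedFDeriv_mul_cosPoly_le_graded {g : Momentum → ℝ} (hg : ContDiff ℝ (⊤ : ℕ∞) g) (B : Finset (Fin 2 → ℤ)) (c : (Fin 2 → ℤ) → ℝ)
    {P : Momentum → ℝ} (hP : ∀ q : Momentum, P q = ∑ y ∈ B, c y * Real.cos (∑ i : Fin 2, (y i : ℝ) * q i))
    {j : ℕ} {q : Momentum} {Dq : ℕ → ℝ} (hDq : ∀ i ≤ j, ‖iteratedFDeriv ℝ i g q‖ ≤ Dq i) :
    ‖iteratedFDeriv ℝ j (fun q => g q * P q) q‖ ≤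
      ∑ i ∈ range (j + 1), (j.choose i : ℝ) * (Dq i * ∑ y ∈ B, |c y| * (1 + |((y 0 : ℤ) : ℝ)| + |((y 1 : ℤ) : ℝ)|) ^ (j - i)) := by
  have hPfun : P = fun q : Momentum => ∑ y ∈ B, c y * Real.cos (∑ i : Fin 2, (y i : ℝ) * q i) := funext hP
  have hP' : ContDiff ℝ (⊤ : ℕ∞) P := by
    rw [hPfun]; exact ContDiff.sum fun y _ => contDiff_const.mul (contDiff_cos_planeWave y)
  have hN : ((j : ℕ∞) : WithTop ℕ∞) ≤ ((⊤ : ℕ∞) : WithTop ℕ∞) := by exact_mod_cast le_top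
  refine (norm_iteratedFDeriv_mul_le hg hP' q hN).trans (sum_le_sum fun i hi => ?_)
  have hij : i ≤ j := Nat.lt_succ_iff.1 (mem_range.1 hi)
  have h1 := hDq i hij
  have hDq0 : 0 ≤ Dq i := (norm_nonneg _).trans h1
  have h2 : ‖iteratedFDeriv ℝ (j - i) P q‖ ≤ ∑ y ∈ B, |c y| * (1 + |((y 0 : ℤ) : ℝ)| + |((y 1 : ℤ) : ℝ)|) ^ (j - i) := by
    rw [hPfun]; exact norm_iteratedFDeriv_cosPoly_le B c (j - i) q
  calc (j.choose i : ℝ) * ‖iteratedFDeriv ℝ i g q‖ * ‖iteratedFDeriv ℝ (j - i) P q‖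
      = (j.choose i : ℝ) * (‖iteratedFDeriv ℝ i g q‖ * ‖iteratedFDeriv ℝ (j - i) P q‖) := by ring
    _ ≤ (j.choose i : ℝ) * (Dq i * ∑ y ∈ B, |c y| * (1 + |((y 0 : ℤ) : ℝ)| + |((y 1 : ℤ) : ℝ)|) ^ (j - i)) :=
        mul_le_mul_of_nonneg_left (mul_le_mul h1 h2 (norm_nonneg _) hDq0) (Nat.cast_nonneg _)

end Leibniz

/-! ## §2 The last-scale dressed aliasing lemma, graded -/

section Last

/-- **THE LAST-SCALE DRESSED ALIASING LEMMA, GRADED LEIBNIZ.**  As `norm_iteratedFDeriv_evalM_symInterp_dressed_le_of_jets` (p593524) but with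
per-order jets `‖Dⁱg(q)‖ ≤ D_{q,i}` and per-order position moments `Σ_x (1+|x̃₀|+|x̃₁|)ᵏ‖𝔉⁻¹H(x)‖ ≤ M_k` (`k ≤ j`): the Leibniz term is
`2·Σ_{i≤j} C(j,i)·D_{q,i}·M_{j−i}`; the aliasing and far terms are unchanged (`M_j`, `M_s`). [cite: BenfattoGiulianiMastropietro2006, §2.3 (2.17)] -/
theorem norm_iteratedFDeriv_evalM_symInterp_dressed_le_of_jets_graded {g : Momentum → ℂ}
    (hgper : ∀ (i : Fin 2) (q : Momentum), g (q + EuclideanSpace.single i (2 * π)) = g q) (hg : ContDiff ℝ (⊤ : ℕ∞) g)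
    (hrefl : ∀ p : Fin 2 → ℝ, g (WithLp.toLp 2 ![p 0, -p 1]) = g (WithLp.toLp 2 p))
    (hswap : ∀ p : Fin 2 → ℝ, g (WithLp.toLp 2 ![p 1, p 0]) = g (WithLp.toLp 2 p))
    (H : TorusSite 2 L → ℂ) {j M : ℕ} (hM : 4 + j ≤ M) {Dg : ℝ} (hDg : ∀ q, ‖iteratedFDeriv ℝ M g q‖ ≤ Dg) {A₀ : ℝ} (hA₀ : ∀ q, ‖g q‖ ≤ A₀)
    {Mm : ℕ → ℝ} (hMm : ∀ k ≤ j, ∑ x : TorusSite 2 L, (1 + ((x 0).valMinAbs.natAbs : ℝ) + ((x 1).valMinAbs.natAbs : ℝ)) ^ k * ‖torusFourierInv H x‖ ≤ Mm k)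
    {s : ℕ} {Ms : ℝ} (hMs : ∑ x : TorusSite 2 L, (1 + ((x 0).valMinAbs.natAbs : ℝ) + ((x 1).valMinAbs.natAbs : ℝ)) ^ s * ‖torusFourierInv H x‖ ≤ Ms)
    {q : Momentum} {Dq : ℕ → ℝ} (hDq : ∀ i ≤ j, ‖iteratedFDeriv ℝ i g q‖ ≤ Dq i) :
    ‖iteratedFDeriv ℝ j (evalM (symInterp L (fun k : TorusSite 2 L => (g (WithLp.toLp 2 (latticeMomentum L k)) * H k).re))) q‖ ≤
      (2 * (∑ i ∈ range (j + 1), (j.choose i : ℝ) * (Dq i * Mm (j - i))) + 2 * (2 * (Mm j * ((3 : ℝ) ^ j * Dg * (2 / ((2 * (L / 4 + 1) : ℕ) : ℝ)) ^ (M - j - 4) *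
        (2 ^ 2 * ∑' k : Fin 2 → ℤ, ∏ i, (1 + (k i : ℝ) ^ 2)⁻¹))))) +
        (L : ℝ) ^ 2 * (L : ℝ) ^ j * (A₀ * (Ms / (1 + (L : ℝ) / 4) ^ s)) := by
  classical
  -- names
  set G : TorusSite 2 L → ℂ := fun k => g (WithLp.toLp 2 (latticeMomentum L k)) with hG
  set near : Finset (TorusSite 2 L) := univ.filter (fun x : TorusSite 2 L => ∀ i, 4 * |(x i).valMinAbs| ≤ (L : ℤ)) with hnear
  set far : Finset (TorusSite 2 L) := univ.filter (fun x : TorusSite 2 L => ¬ ∀ i, 4 * |(x i).valMinAbs| ≤ (L : ℤ)) with hfar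
  set gre : Momentum → ℝ := fun q => (g q).re with hgre
  set gim : Momentum → ℝ := fun q => (g q).im with hgim
  set P₁ : Momentum → ℝ := fun q => ∑ x ∈ near, (torusFourierInv H x).re * TrigPolyC4v.harmonic (x 0).valMinAbs.natAbs (x 1).valMinAbs.natAbs (WithLp.ofLp q)
    with hP₁
  set P₂ : Momentum → ℝ := fun q => ∑ x ∈ near, (torusFourierInv H x).im * TrigPolyC4v.harmonic (x 0).valMinAbs.natAbs (x 1).valMinAbs.natAbs (WithLp.ofLp q)
    with hP₂
  set ffar : TorusSite 2 L → ℝ := fun k => ∑ x ∈ far, (G k * torusFourierInv H x).re *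
    TrigPolyC4v.harmonic (x 0).valMinAbs.natAbs (x 1).valMinAbs.natAbs (latticeMomentum L k) with hffar
  -- `G` is `B₂`-invariant
  have hGn : ∀ k, G (-k) = G k := fun k => sample_comp_neg hgper hrefl hswap k
  have hGr : ∀ k, G ![k 0, -k 1] = G k := fun k => sample_comp_reflect hgper hrefl k
  have hGs : ∀ k, G ![k 1, k 0] = G k := fun k => sample_comp_swap (L := L) hswap k
  -- the data split: `Re(G·H) ↦ (Re g·P₁ − Im g·P₂)∘p + far`, under the interpolant
  have hsplit : ∀ k : TorusSite 2 L, (∑ x : TorusSite 2 L, (G k * torusFourierInv H x).re *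
      TrigPolyC4v.harmonic (x 0).valMinAbs.natAbs (x 1).valMinAbs.natAbs (latticeMomentum L k)) =
      ((fun q => gre q * P₁ q) (WithLp.toLp 2 (latticeMomentum L k)) - (fun q => gim q * P₂ q) (WithLp.toLp 2 (latticeMomentum L k))) + ffar k := by
    intro k
    rw [← sum_filter_add_sum_filter_not univ (fun x : TorusSite 2 L => ∀ i, 4 * |(x i).valMinAbs| ≤ (L : ℤ))]
    simp only [hgre, hgim, hP₁, hP₂, hffar, hG, mul_sum, ← sum_sub_distrib]
    congr 1
    refine sum_congr rfl fun x _ => ?_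
    rw [Complex.mul_re]
    ring
  have hfun : evalM (symInterp L (fun k : TorusSite 2 L => (g (WithLp.toLp 2 (latticeMomentum L k)) * H k).re)) = fun q' =>
      (evalM (symInterp L (fun k => (fun q => gre q * P₁ q) (WithLp.toLp 2 (latticeMomentum L k)))) q' -
        evalM (symInterp L (fun k => (fun q => gim q * P₂ q) (WithLp.toLp 2 (latticeMomentum L k)))) q') +
        evalM (symInterp L ffar) q' := by
    funext q'
    rw [evalM_apply, eval_symInterp_dressed_eq_harmonics G H hGn hGr hGs]
    simp_rw [hsplit]
    rw [eval_symInterp_add L _ ffar, eval_symInterp_sub L]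
    rfl
  -- smoothness of the three interpolants and the splitting of the jet
  have hN : ((j : ℕ∞) : WithTop ℕ∞) ≤ ((⊤ : ℕ∞) : WithTop ℕ∞) := by exact_mod_cast le_top
  have hc1 : ContDiff ℝ j (evalM (symInterp L (fun k => (fun q => gre q * P₁ q) (WithLp.toLp 2 (latticeMomentum L k))))) := contDiff_evalM _
  have hc2 : ContDiff ℝ j (evalM (symInterp L (fun k => (fun q => gim q * P₂ q) (WithLp.toLp 2 (latticeMomentum L k))))) := contDiff_evalM _
  have hc3 : ContDiff ℝ j (evalM (symInterp L ffar)) := contDiff_evalM _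
  rw [hfun, fun_iteratedFDeriv_add_apply (hc1.sub hc2).contDiffAt hc3.contDiffAt, fun_iteratedFDeriv_sub_apply hc1.contDiffAt hc2.contDiffAt]
  refine (norm_add_le _ _).trans (add_le_add ((norm_sub_le _ _).trans ?_) ?_)
  · -- the two main terms through c4a-1's generic lemma
    have hgre_per : ∀ (i : Fin 2) (q : Momentum), gre (q + EuclideanSpace.single i (2 * π)) = gre q := fun i q => by
      simp only [hgre, hgper]
    have hgim_per : ∀ (i : Fin 2) (q : Momentum), gim (q + EuclideanSpace.single i (2 * π)) = gim q := fun i q => by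
      simp only [hgim, hgper]
    have hgre_sm : ContDiff ℝ (⊤ : ℕ∞) gre := Complex.reCLM.contDiff.comp hg
    have hgim_sm : ContDiff ℝ (⊤ : ℕ∞) gim := Complex.imCLM.contDiff.comp hg
    have hDre : ∀ q, ‖iteratedFDeriv ℝ M gre q‖ ≤ Dg := fun q => ((norm_iteratedFDeriv_re_im_le hg M q).1).trans (hDg q)
    have hDim : ∀ q, ‖iteratedFDeriv ℝ M gim q‖ ≤ Dg := fun q => ((norm_iteratedFDeriv_re_im_le hg M q).2).trans (hDg q)
    have hflat_re : ∀ (i : Fin 2) (t : UnitAddTorus (Fin 2)),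
        ‖((Literature.Analysis.FunctionSpaces.Torus.partialDeriv i)^[M] (symbolFlat gre hgre_per)) t‖ ≤ (2 * π) ^ M * Dg :=
      norm_partialDeriv_iterate_symbolFlat_le hgre_per hgre_sm hDre
    have hflat_im : ∀ (i : Fin 2) (t : UnitAddTorus (Fin 2)),
        ‖((Literature.Analysis.FunctionSpaces.Torus.partialDeriv i)^[M] (symbolFlat gim hgim_per)) t‖ ≤ (2 * π) ^ M * Dg :=
      norm_partialDeriv_iterate_symbolFlat_le hgim_per hgim_sm hDim
    have hw_re := summable_weighted_symbolFlat_of_deriv hgre_per hgre_sm hM hflat_re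
    have hw_im := summable_weighted_symbolFlat_of_deriv hgim_per hgim_sm hM hflat_im
    have hG_re := quarterTail_weighted_le (L := L) hgre_per hgre_sm hM hflat_re
    have hG_im := quarterTail_weighted_le (L := L) hgim_per hgim_sm hM hflat_im
    have hDg0 : 0 ≤ Dg := (norm_nonneg _).trans (hDg q)
    have h2π : (2 * π) ^ M * Dg / (2 * π) ^ M = Dg := by field_simp
    rw [h2π] at hG_re hG_im
    -- the near polynomials in the `(B,c)` currency
    obtain ⟨B₁, c₁, hB₁, hP₁', hM₁⟩ := exists_trigPoly_of_near_harmonics (L := L) (fun x => (torusFourierInv H x).re)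
    obtain ⟨B₂, c₂, hB₂, hP₂', hM₂⟩ := exists_trigPoly_of_near_harmonics (L := L) (fun x => (torusFourierInv H x).im)
    have hP₁q : ∀ q : Momentum, P₁ q = ∑ y ∈ B₁, c₁ y * Real.cos (∑ i : Fin 2, (y i : ℝ) * q i) := fun q => hP₁' (WithLp.ofLp q)
    have hP₂q : ∀ q : Momentum, P₂ q = ∑ y ∈ B₂, c₂ y * Real.cos (∑ i : Fin 2, (y i : ℝ) * q i) := fun q => hP₂' (WithLp.ofLp q)
    -- symmetry of the two products
    have hh : ∀ (x : TorusSite 2 L) (p : Fin 2 → ℝ),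
        TrigPolyC4v.harmonic (x 0).valMinAbs.natAbs (x 1).valMinAbs.natAbs ![p 0, -p 1] =
          TrigPolyC4v.harmonic (x 0).valMinAbs.natAbs (x 1).valMinAbs.natAbs p ∧
        TrigPolyC4v.harmonic (x 0).valMinAbs.natAbs (x 1).valMinAbs.natAbs ![p 1, p 0] =
          TrigPolyC4v.harmonic (x 0).valMinAbs.natAbs (x 1).valMinAbs.natAbs p :=
      fun x p => ⟨TrigPolyC4v.harmonic_reflect _ _ p, TrigPolyC4v.harmonic_swap _ _ p⟩
    have hrefl₁ : ∀ p : Fin 2 → ℝ, (fun q => gre q * P₁ q) (WithLp.toLp 2 ![p 0, -p 1]) = (fun q => gre q * P₁ q) (WithLp.toLp 2 p) := by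
      intro p; simp only [hgre, hP₁, hrefl, (hh _ p).1]
    have hswap₁ : ∀ p : Fin 2 → ℝ, (fun q => gre q * P₁ q) (WithLp.toLp 2 ![p 1, p 0]) = (fun q => gre q * P₁ q) (WithLp.toLp 2 p) := by
      intro p; simp only [hgre, hP₁, hswap, (hh _ p).2]
    have hrefl₂ : ∀ p : Fin 2 → ℝ, (fun q => gim q * P₂ q) (WithLp.toLp 2 ![p 0, -p 1]) = (fun q => gim q * P₂ q) (WithLp.toLp 2 p) := by
      intro p; simp only [hgim, hP₂, hrefl, (hh _ p).1]
    have hswap₂ : ∀ p : Fin 2 → ℝ, (fun q => gim q * P₂ q) (WithLp.toLp 2 ![p 1, p 0]) = (fun q => gim q * P₂ q) (WithLp.toLp 2 p) := by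
      intro p; simp only [hgim, hP₂, hswap, (hh _ p).2]
    -- the Leibniz terms at `q` (no vanishing at the last scale)
    have hDqi0 : ∀ i ≤ j, 0 ≤ Dq i := fun i hi => (norm_nonneg _).trans (hDq i hi)
    have hJre : ‖iteratedFDeriv ℝ j (fun q => gre q * P₁ q) q‖ ≤
        ∑ i ∈ range (j + 1), (j.choose i : ℝ) * (Dq i * ∑ y ∈ B₁, |c₁ y| * (1 + |((y 0 : ℤ) : ℝ)| + |((y 1 : ℤ) : ℝ)|) ^ (j - i)) :=
      norm_iteratedFDeriv_mul_cosPoly_le_graded hgre_sm B₁ c₁ hP₁q fun i hi => ((norm_iteratedFDeriv_re_im_le hg i q).1).trans (hDq i hi)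
    have hJim : ‖iteratedFDeriv ℝ j (fun q => gim q * P₂ q) q‖ ≤
        ∑ i ∈ range (j + 1), (j.choose i : ℝ) * (Dq i * ∑ y ∈ B₂, |c₂ y| * (1 + |((y 0 : ℤ) : ℝ)| + |((y 1 : ℤ) : ℝ)|) ^ (j - i)) :=
      norm_iteratedFDeriv_mul_cosPoly_le_graded hgim_sm B₂ c₂ hP₂q fun i hi => ((norm_iteratedFDeriv_re_im_le hg i q).2).trans (hDq i hi)
    -- c4a-1's lemma, twice
    have h₁ := norm_iteratedFDeriv_evalM_symInterp_mul_trigPoly_le hgre_per hgre_sm B₁ c₁ hB₁ hP₁q hrefl₁ hswap₁ hw_re le_rfl q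
    have h₂ := norm_iteratedFDeriv_evalM_symInterp_mul_trigPoly_le hgim_per hgim_sm B₂ c₂ hB₂ hP₂q hrefl₂ hswap₂ hw_im le_rfl q
    -- the moments of the aggregated coefficients
    have hwt : ∀ (k : ℕ) (x : TorusSite 2 L), 0 ≤ (1 + ((x 0).valMinAbs.natAbs : ℝ) + ((x 1).valMinAbs.natAbs : ℝ)) ^ k := fun k x => by positivity
    have hMre : ∀ k ≤ j, ∑ y ∈ B₁, |c₁ y| * (1 + |((y 0 : ℤ) : ℝ)| + |((y 1 : ℤ) : ℝ)|) ^ k ≤ Mm k := by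
      intro k hk
      refine (hM₁ k).trans (le_trans ?_ (hMm k hk))
      refine (sum_le_sum_of_subset_of_nonneg (filter_subset _ _) fun x _ _ => by positivity).trans (sum_le_sum fun x _ => ?_)
      rw [mul_comm]
      exact mul_le_mul_of_nonneg_left (Complex.abs_re_le_norm _) (hwt k x)
    have hMim : ∀ k ≤ j, ∑ y ∈ B₂, |c₂ y| * (1 + |((y 0 : ℤ) : ℝ)| + |((y 1 : ℤ) : ℝ)|) ^ k ≤ Mm k := by
      intro k hk
      refine (hM₂ k).trans (le_trans ?_ (hMm k hk))
      refine (sum_le_sum_of_subset_of_nonneg (filter_subset _ _) fun x _ _ => by positivity).trans (sum_le_sum fun x _ => ?_)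
      rw [mul_comm]
      exact mul_le_mul_of_nonneg_left (Complex.abs_im_le_norm _) (hwt k x)
    -- the graded Leibniz sums against the moments `Mm`
    have hS₁ : ∑ i ∈ range (j + 1), (j.choose i : ℝ) * (Dq i * ∑ y ∈ B₁, |c₁ y| * (1 + |((y 0 : ℤ) : ℝ)| + |((y 1 : ℤ) : ℝ)|) ^ (j - i)) ≤
        ∑ i ∈ range (j + 1), (j.choose i : ℝ) * (Dq i * Mm (j - i)) := by
      refine sum_le_sum fun i hi => ?_
      have hij : i ≤ j := Nat.lt_succ_iff.1 (mem_range.1 hi)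
      exact mul_le_mul_of_nonneg_left (mul_le_mul_of_nonneg_left (hMre (j - i) (Nat.sub_le _ _)) (hDqi0 i hij)) (Nat.cast_nonneg _)
    have hS₂ : ∑ i ∈ range (j + 1), (j.choose i : ℝ) * (Dq i * ∑ y ∈ B₂, |c₂ y| * (1 + |((y 0 : ℤ) : ℝ)| + |((y 1 : ℤ) : ℝ)|) ^ (j - i)) ≤
        ∑ i ∈ range (j + 1), (j.choose i : ℝ) * (Dq i * Mm (j - i)) := by
      refine sum_le_sum fun i hi => ?_
      have hij : i ≤ j := Nat.lt_succ_iff.1 (mem_range.1 hi)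
      exact mul_le_mul_of_nonneg_left (mul_le_mul_of_nonneg_left (hMim (j - i) (Nat.sub_le _ _)) (hDqi0 i hij)) (Nat.cast_nonneg _)
    have hGpos : 0 ≤ (3 : ℝ) ^ j * Dg * (2 / ((2 * (L / 4 + 1) : ℕ) : ℝ)) ^ (M - j - 4) * (2 ^ 2 * ∑' k : Fin 2 → ℤ, ∏ i, (1 + (k i : ℝ) ^ 2)⁻¹) := by
      have : 0 ≤ ∑' k : Fin 2 → ℤ, ∏ i, (1 + (k i : ℝ) ^ 2)⁻¹ := tsum_nonneg fun k => prod_nonneg fun i _ => by positivity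
      positivity
    have hM1pos : 0 ≤ ∑ y ∈ B₁, |c₁ y| * (1 + |((y 0 : ℤ) : ℝ)| + |((y 1 : ℤ) : ℝ)|) ^ j := sum_nonneg fun y _ => by positivity
    have hM2pos : 0 ≤ ∑ y ∈ B₂, |c₂ y| * (1 + |((y 0 : ℤ) : ℝ)| + |((y 1 : ℤ) : ℝ)|) ^ j := sum_nonneg fun y _ => by positivity
    have hG₁ := mul_le_mul_of_nonneg_right (hMre j le_rfl) hGpos
    have hG₂ := mul_le_mul_of_nonneg_right (hMim j le_rfl) hGpos
    calc ‖iteratedFDeriv ℝ j (evalM (symInterp L fun k => (fun q => gre q * P₁ q) (WithLp.toLp 2 (latticeMomentum L k)))) q‖ +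
          ‖iteratedFDeriv ℝ j (evalM (symInterp L fun k => (fun q => gim q * P₂ q) (WithLp.toLp 2 (latticeMomentum L k)))) q‖
        ≤ ((∑ i ∈ range (j + 1), (j.choose i : ℝ) * (Dq i * ∑ y ∈ B₁, |c₁ y| * (1 + |((y 0 : ℤ) : ℝ)| + |((y 1 : ℤ) : ℝ)|) ^ (j - i))) +
            2 * ((∑ y ∈ B₁, |c₁ y| * (1 + |((y 0 : ℤ) : ℝ)| + |((y 1 : ℤ) : ℝ)|) ^ j) * ((3 : ℝ) ^ j * Dg * (2 / ((2 * (L / 4 + 1) : ℕ) : ℝ)) ^ (M - j - 4) * (2 ^ 2 * ∑' k : Fin 2 → ℤ, ∏ i, (1 + (k i : ℝ) ^ 2)⁻¹)))) +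
          ((∑ i ∈ range (j + 1), (j.choose i : ℝ) * (Dq i * ∑ y ∈ B₂, |c₂ y| * (1 + |((y 0 : ℤ) : ℝ)| + |((y 1 : ℤ) : ℝ)|) ^ (j - i))) +
            2 * ((∑ y ∈ B₂, |c₂ y| * (1 + |((y 0 : ℤ) : ℝ)| + |((y 1 : ℤ) : ℝ)|) ^ j) * ((3 : ℝ) ^ j * Dg * (2 / ((2 * (L / 4 + 1) : ℕ) : ℝ)) ^ (M - j - 4) * (2 ^ 2 * ∑' k : Fin 2 → ℤ, ∏ i, (1 + (k i : ℝ) ^ 2)⁻¹)))) := by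
          refine add_le_add (h₁.trans (add_le_add hJre ?_)) (h₂.trans (add_le_add hJim ?_))
          · exact mul_le_mul_of_nonneg_left (mul_le_mul_of_nonneg_left hG_re hM1pos) (by norm_num)
          · exact mul_le_mul_of_nonneg_left (mul_le_mul_of_nonneg_left hG_im hM2pos) (by norm_num)
      _ ≤ 2 * (∑ i ∈ range (j + 1), (j.choose i : ℝ) * (Dq i * Mm (j - i))) + 2 * (2 * (Mm j * ((3 : ℝ) ^ j * Dg * (2 / ((2 * (L / 4 + 1) : ℕ) : ℝ)) ^ (M - j - 4) * (2 ^ 2 * ∑' k : Fin 2 → ℤ, ∏ i, (1 + (k i : ℝ) ^ 2)⁻¹)))) := by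
          linarith
  · -- the far part
    have hA₀' : ∀ k : TorusSite 2 L, ‖G k‖ ≤ A₀ := fun k => hA₀ _
    have hR : (0 : ℝ) ≤ (L : ℝ) / 4 := by positivity
    have hT : ∑ x ∈ far, ‖torusFourierInv H x‖ ≤ Ms / (1 + (L : ℝ) / 4) ^ s := by
      have h := sum_far_momentWeight_norm_torusFourierInv_le H (j := 0) (s := s) (Nat.zero_le _) hR hMs
      simp only [pow_zero, one_mul, Nat.sub_zero] at h
      exact (sum_le_sum_of_subset_of_nonneg farSites_subset fun x _ _ => norm_nonneg _).trans h
    exact norm_iteratedFDeriv_evalM_symInterp_farHarmonics_le G hA₀' (torusFourierInv H) far hT j q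

end Last

end Summit.HubbardSuperconductivity.HubbardSuperconductivity.Theorems.EngineV8

end
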